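import Literature.NumberTheory.EllipticCurves.TwoDescentLocalTwo
import Summits.BirchSwinnertonDyer.BirchSwinnertonDyer.Theorems.Rank2ObservatoryTwoDescentLocalMultDeep
import Summits.BirchSwinnertonDyer.BirchSwinnertonDyer.Theorems.Rank2ObservatoryTwoDescentLocalTwoImageTable
import HarnessLib

/-!
# Rank-2 observatory — the `2`-adic image of the complete `2`-descent, configuration `(0,0,m)`

HONEST FRAMING: per-curve certified theorems and census instruments; no claim on BSD in rank ≥ 2.

Let `y² = (x - e₁)(x - e₂)(x - e₃)` with `e₂ - e₁` odd and `e₃ - e₂ = 2^m u`, `u` odd, `m ≥ 1`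
(so `e₁` is the root isolated modulo `2`). For every rational point with `y ≠ 0` the six bits
`(v₂ mod 2, χ₄, χ₈)` of `x - e₁` and of `x - e₂` lie in the decision table `w00 m (e₂ - e₁) u` of
`Rank2ObservatoryTwoDescentLocalTwoImageTable.lean` (`w00_of_point`). The proof is the case analysis
on `v = v₂(x - e₁)`: `v < 0` (all three factors have valuation `v`, even), `v > 0` (even; the other
two factors are units), `v = 0` (then `t = v₂(x - e₂) ≥ 1`, and `t < m`, `t > m` with `t - m` even,
or `t = m` with `v₂(x - e₃) - m ≥ 2` even), reading residues modulo `8` with the ultrametric rule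
`res8 (a + b) = res8 a + 2^k res8 b` (`v₂ b = v₂ a + k`, `k ≥ 1`). The per-curve files evaluate the
table by `decide` and linearise `χ₄`, `χ₈` in the sign/parity coordinates.

## References

* J. H. Silverman, *The Arithmetic of Elliptic Curves*, 2nd ed., GTM 106 (2009), Prop. X.1.4,
  Example X.1.5. [SilvermanAEC2009]
* J. E. Cremona, *Algorithms for Modular Elliptic Curves*, 2nd ed. (1997), Sec. 3.6. [CremonaAlgorithms1997]
-/

open scoped Classical

set_option linter.dupNamespace false

namespace Summit.BirchSwinnertonDyer.BirchSwinnertonDyer.Rank2Observatory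

open Literature.NumberTheory.EllipticCurves.TwoDescentLocal
open Literature.NumberTheory.EllipticCurves.KramerTwoDescent
open Literature.Barriers.BirchSwinnertonDyer.DokchitserDokchitser2011 (two_pow_eq_zero_of_le)

variable {e₁ e₂ e₃ : ℤ} {x y : ℚ}

/-- An odd integer difference: non-zero, a `2`-adic unit, residue = reduction mod `8`. [folklore] -/
theorem oddDiff_facts {p q : ℤ} (h : ¬ (2 : ℤ) ∣ p - q) :
    ((p : ℚ) - q) ≠ 0 ∧ padicValRat 2 ((p : ℚ) - q) = 0 ∧
      res8 ((p : ℚ) - q) = ((p - q : ℤ) : ZMod (2 ^ 3)) := by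
  have hne : p - q ≠ 0 := by intro h0; rw [h0] at h; exact h (dvd_zero 2)
  refine ⟨by exact_mod_cast hne, ?_, ?_⟩
  · have := padicValRat_intCast_eq_zero (p := 2) (z := p - q) (by exact_mod_cast h)
    rwa [(Int.cast_sub p q : ((p - q : ℤ) : ℚ) = p - q)] at this
  · have := res8_intCast (z := p - q) h
    rwa [(Int.cast_sub p q : ((p - q : ℤ) : ℚ) = p - q)] at this

/-- `2^m u`, `u` odd: non-zero, valuation `m`, residue `u mod 8`. [folklore] -/
theorem twoPowMul_facts {m : ℕ} {u : ℤ} (hu : ¬ (2 : ℤ) ∣ u) :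
    ((2 : ℚ) ^ m * u) ≠ 0 ∧ padicValRat 2 ((2 : ℚ) ^ m * u) = m ∧
      res8 ((2 : ℚ) ^ m * u) = ((u : ℤ) : ZMod (2 ^ 3)) := by
  have hu0 : (u : ℚ) ≠ 0 := by
    have : u ≠ 0 := by rintro rfl; exact hu (dvd_zero 2)
    exact_mod_cast this
  have h20 : ((2 : ℚ) ^ m) ≠ 0 := pow_ne_zero _ two_ne_zero
  refine ⟨mul_ne_zero h20 hu0, ?_, ?_⟩
  · have h2 : padicValRat 2 (2 : ℚ) = 1 := by
      have := padicValRat.self (p := 2) one_lt_two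
      simpa using this
    rw [padicValRat.mul h20 hu0, padicValRat.pow (2 : ℚ), h2,
      padicValRat_intCast_eq_zero (p := 2) (by exact_mod_cast hu)]
    ring
  · rw [← zpow_natCast, res8_two_zpow_mul (m : ℤ) hu0, res8_intCast hu]

/-- **The `2`-adic image, configuration `(0,0,m)`.** With `e₂ - e₁` odd, `e₃ - e₂ = 2^m u`, `u` odd,
`m ≥ 1`: for every rational point `(x, y)`, `y ≠ 0`, of `y² = (x - e₁)(x - e₂)(x - e₃)` the six bits
`(v₂ mod 2, χ₄, χ₈)` of `x - e₁`, `x - e₂` lie in the table `w00 m (e₂ - e₁) u`.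
[cite: SilvermanAEC2009, Prop. X.1.4, Example X.1.5] -/
theorem w00_of_point {m : ℕ} {u : ℤ} (hm : 1 ≤ m) (ha : ¬ (2 : ℤ) ∣ e₂ - e₁) (hu : ¬ (2 : ℤ) ∣ u)
    (h₂₃ : e₃ - e₂ = 2 ^ m * u) (hy : y ≠ 0) (h : y ^ 2 = (x - e₁) * (x - e₂) * (x - e₃)) :
    w00 m ((e₂ - e₁ : ℤ) : ZMod (2 ^ 3)) ((u : ℤ) : ZMod (2 ^ 3))
      (parityBit 2 (x - e₁), chi4 (x - e₁), chi8 (x - e₁),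
        parityBit 2 (x - e₂), chi4 (x - e₂), chi8 (x - e₂)) = true := by
  obtain ⟨hd₁, hd₂, hd₃⟩ := factors_ne_zero hy h
  -- the integer data
  have h₃₁ : e₃ - e₁ = (e₂ - e₁) + 2 ^ m * u := by rw [← h₂₃]; ring
  have hb : ¬ (2 : ℤ) ∣ e₃ - e₁ := by
    rw [h₃₁]; intro hd
    exact ha ((dvd_add_left (dvd_mul_of_dvd_left (dvd_pow_self 2 (by omega)) u)).mp hd)
  have ha' : ¬ (2 : ℤ) ∣ e₁ - e₂ := fun hd => ha (by omega)
  have hb' : ¬ (2 : ℤ) ∣ e₁ - e₃ := fun hd => hb (by omega)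
  obtain ⟨ha0, hva, hra⟩ := oddDiff_facts ha
  obtain ⟨ha0', hva', hra'⟩ := oddDiff_facts ha'
  obtain ⟨hb0, hvb, hrb⟩ := oddDiff_facts hb
  obtain ⟨hb0', hvb', hrb'⟩ := oddDiff_facts hb'
  have hra'' : res8 ((e₁ : ℚ) - e₂) = -(((e₂ - e₁ : ℤ)) : ZMod (2 ^ 3)) := by
    rw [hra', ← Int.cast_neg, neg_sub]
  have hrb'' : res8 ((e₁ : ℚ) - e₃) = -(((e₃ - e₁ : ℤ)) : ZMod (2 ^ 3)) := by
    rw [hrb', ← Int.cast_neg, neg_sub]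
  obtain ⟨hc0', hvc', hrc'⟩ := twoPowMul_facts (m := m) hu
  have h23Q : (e₃ : ℚ) - e₂ = (2 : ℚ) ^ m * u := by exact_mod_cast h₂₃
  rw [← h23Q] at hc0' hvc' hrc'
  have hcQ : (e₂ : ℚ) - e₃ = -((e₃ : ℚ) - e₂) := by ring
  have hc0 : (e₂ : ℚ) - e₃ ≠ 0 := by rw [hcQ]; exact neg_ne_zero.mpr hc0'
  have hvc : padicValRat 2 ((e₂ : ℚ) - e₃) = m := by rw [hcQ, padicValRat.neg, hvc']
  have hrc : res8 ((e₂ : ℚ) - e₃) = -((u : ℤ) : ZMod (2 ^ 3)) := by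
    rw [hcQ, show -((e₃ : ℚ) - e₂) = (-1 : ℚ) * ((e₃ : ℚ) - e₂) by ring, res8_mul (by norm_num) hc0',
      hrc', show (-1 : ℚ) = ((-1 : ℤ) : ℚ) by norm_num, res8_intCast (by decide)]
    push_cast; ring
  have hab : ((e₃ - e₁ : ℤ) : ZMod (2 ^ 3)) = ((e₂ - e₁ : ℤ) : ZMod (2 ^ 3)) + 2 ^ m * ((u : ℤ) : ZMod (2 ^ 3)) := by
    rw [h₃₁]; push_cast; ring
  set a : ZMod (2 ^ 3) := ((e₂ - e₁ : ℤ) : ZMod (2 ^ 3)) with ha_def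
  set u8 : ZMod (2 ^ 3) := ((u : ℤ) : ZMod (2 ^ 3)) with hu8_def
  set b : ZMod (2 ^ 3) := ((e₃ - e₁ : ℤ) : ZMod (2 ^ 3)) with hb_def
  -- the product of the three residues is `res8 (y²) = 1`
  have hprod : res8 (x - (e₁ : ℚ)) * res8 (x - (e₂ : ℚ)) * res8 (x - (e₃ : ℚ)) = 1 := by
    have h1 : res8 (y ^ 2) = res8 (x - (e₁ : ℚ)) * res8 (x - (e₂ : ℚ)) * res8 (x - (e₃ : ℚ)) := by
      rw [h, res8_mul (mul_ne_zero hd₁ hd₂) hd₃, res8_mul hd₁ hd₂]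
    rw [← h1, res8_sq, sq, res8_mul_self hy]
  have hrr₁ : res8 (x - (e₁ : ℚ)) * res8 (x - (e₁ : ℚ)) = 1 := res8_mul_self hd₁
  have hrr₂ : res8 (x - (e₂ : ℚ)) * res8 (x - (e₂ : ℚ)) = 1 := res8_mul_self hd₂
  have hrr₃ : res8 (x - (e₃ : ℚ)) * res8 (x - (e₃ : ℚ)) = 1 := res8_mul_self hd₃
  have hsum := even_sum_padicValRat (p := 2) hy h
  have hev : Even (padicValRat 2 (x - e₁)) :=
    even_padicValRat_sub_of_mult_deep (p := 2) (m := m) ha' hb' hm hvc hy h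
  set v := padicValRat 2 (x - e₁) with hv
  set t := padicValRat 2 (x - e₂) with ht
  -- the decompositions used below
  have hx₂ : x - (e₂ : ℚ) = (x - e₁) + ((e₁ : ℚ) - e₂) := by ring
  have hx₂' : x - (e₂ : ℚ) = ((e₁ : ℚ) - e₂) + (x - e₁) := by ring
  have hx₃ : x - (e₃ : ℚ) = (x - e₁) + ((e₁ : ℚ) - e₃) := by ring
  have hx₃' : x - (e₃ : ℚ) = ((e₁ : ℚ) - e₃) + (x - e₁) := by ring
  rcases lt_trichotomy v 0 with hneg | hzero | hpos
  · -- (A) `v < 0`, even: `k = -v ≥ 2`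
    obtain ⟨k, hk⟩ := Int.eq_ofNat_of_zero_le (show 0 ≤ -v by omega)
    have hk24 : k = 2 ∨ 4 ≤ k := by obtain ⟨j, hj⟩ := hev; omega
    have hk1 : 1 ≤ k := by omega
    have he : (2 : ZMod (2 ^ 3)) ^ k = 4 ∨ (2 : ZMod (2 ^ 3)) ^ k = 0 := by
      rcases hk24 with rfl | h4
      · exact Or.inl rfl
      · exact Or.inr (two_pow_eq_zero_of_le (by omega))
    have hv₂ : t = v := by
      rw [ht, hx₂]; exact (padicValRat_add_eq_left hd₁ (Or.inr (by rw [hva']; exact hneg))).2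
    have hv₃ : padicValRat 2 (x - (e₃ : ℚ)) = v := by
      rw [hx₃]; exact (padicValRat_add_eq_left hd₁ (Or.inr (by rw [hvb']; exact hneg))).2
    have hres₂ : res8 (x - (e₂ : ℚ)) = res8 (x - (e₁ : ℚ)) + 2 ^ k * -a := by
      rw [← hra'']; conv_lhs => rw [hx₂]
      exact res8_add_of_eq hd₁ hk1 (by rw [hva', ← hv]; omega)
    have hres₃ : res8 (x - (e₃ : ℚ)) = res8 (x - (e₁ : ℚ)) + 2 ^ k * -b := by
      rw [← hrb'']; conv_lhs => rw [hx₃]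
      exact res8_add_of_eq hd₁ hk1 (by rw [hvb', ← hv]; omega)
    have hp₁ : parityBit 2 (x - (e₁ : ℚ)) = 0 := parityBit_eq_zero_iff.mpr hev
    have hp₂ : parityBit 2 (x - (e₂ : ℚ)) = 0 := parityBit_eq_zero_iff.mpr (by rw [← ht, hv₂]; exact hev)
    rw [hres₂, hres₃] at hprod
    rw [show (parityBit 2 (x - (e₁ : ℚ)), chi4 (x - (e₁ : ℚ)), chi8 (x - (e₁ : ℚ)), parityBit 2 (x - (e₂ : ℚ)),
        chi4 (x - (e₂ : ℚ)), chi8 (x - (e₂ : ℚ))) =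
        twoBits 0 (res8 (x - (e₁ : ℚ))) 0 (res8 (x - (e₁ : ℚ)) + 2 ^ k * -a) by
      simp only [twoBits, chi4, chi8, hres₂, hp₁, hp₂, Nat.cast_zero]]
    exact w00_of_A hab he hrr₁ hprod
  · -- (C) `v = 0`: `t = v₂(x - e₂) ≥ 1`
    have ht1 : 1 ≤ t := by
      have := one_le_padicValRat_two_sub hd₁ (by rw [← hv, hzero]) (a := e₂ - e₁) ha
        (by rw [(Int.cast_sub e₂ e₁ : ((e₂ - e₁ : ℤ) : ℚ) = e₂ - e₁),
              show x - (e₁ : ℚ) - ((e₂ : ℚ) - e₁) = x - e₂ by ring]; exact hd₂)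
      rwa [(Int.cast_sub e₂ e₁ : ((e₂ - e₁ : ℤ) : ℚ) = e₂ - e₁),
        show x - (e₁ : ℚ) - ((e₂ : ℚ) - e₁) = x - e₂ by ring] at this
    obtain ⟨tn, htn⟩ := Int.eq_ofNat_of_zero_le (show 0 ≤ t by omega)
    have htn1 : 1 ≤ tn := by omega
    have hp₁ : parityBit 2 (x - (e₁ : ℚ)) = 0 := parityBit_eq_zero_iff.mpr hev
    have hx₁ : x - (e₁ : ℚ) = ((e₂ : ℚ) - e₁) + (x - e₂) := by ring
    have hy₃ : x - (e₃ : ℚ) = (x - e₂) + ((e₂ : ℚ) - e₃) := by ring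
    have hy₃' : x - (e₃ : ℚ) = ((e₂ : ℚ) - e₃) + (x - e₂) := by ring
    rcases lt_trichotomy t m with hlt | heq | hgt
    · -- (C1) `1 ≤ t < m`
      have htm : tn < m := by omega
      have hv₃ : padicValRat 2 (x - (e₃ : ℚ)) = t := by
        rw [hy₃]; exact (padicValRat_add_eq_left hd₂ (Or.inr (by rw [hvc, ← ht]; exact hlt))).2
      have hres₁ : res8 (x - (e₁ : ℚ)) = a + 2 ^ tn * res8 (x - (e₂ : ℚ)) := by
        rw [← hra]; conv_lhs => rw [hx₁]
        exact res8_add_of_eq ha0 htn1 (by rw [hva, ← ht, htn]; ring)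
      have hres₃ : res8 (x - (e₃ : ℚ)) = res8 (x - (e₂ : ℚ)) + 2 ^ (m - tn) * -u8 := by
        rw [← hrc]; conv_lhs => rw [hy₃]
        exact res8_add_of_eq hd₂ (k := m - tn) (by omega) (by rw [hvc, ← ht, htn]; omega)
      have hp₂ : parityBit 2 (x - (e₂ : ℚ)) = (tn : ZMod 2) :=
        parityBit_two_eq_natCast (by rw [← ht, htn]; simp)
      rw [hres₁, hres₃] at hprod
      rw [show (parityBit 2 (x - (e₁ : ℚ)), chi4 (x - (e₁ : ℚ)), chi8 (x - (e₁ : ℚ)), parityBit 2 (x - (e₂ : ℚ)),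
          chi4 (x - (e₂ : ℚ)), chi8 (x - (e₂ : ℚ))) =
          twoBits 0 (a + 2 ^ tn * res8 (x - (e₂ : ℚ))) tn (res8 (x - (e₂ : ℚ))) by
        simp only [twoBits, chi4, chi8, hres₁, hp₁, hp₂, Nat.cast_zero]]
      exact w00_of_C1 htn1 htm hrr₂ hprod
    · -- (C3) `t = m`: `v₂(x - e₃) = m + s`, `s ≥ 2` even
      -- `x - e₃ = (e₃ - e₂) · ((x - e₂)/(e₃ - e₂) - 1)` and the last factor is a unit minus `1`
      set q : ℚ := (x - e₂) / ((e₃ : ℚ) - e₂) with hq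
      have hq0 : q ≠ 0 := div_ne_zero hd₂ hc0'
      have hvq : padicValRat 2 q = 0 := by
        rw [hq, padicValRat.div hd₂ hc0', ← ht, heq, hvc']; ring
      have hfac : x - (e₃ : ℚ) = ((e₃ : ℚ) - e₂) * (q - (1 : ℤ)) := by
        rw [hq, Int.cast_one, mul_sub, mul_div_cancel₀ _ hc0']; ring
      have hq1 : q - (1 : ℤ) ≠ 0 := by
        intro h0; rw [h0, mul_zero] at hfac; exact hd₃ hfac
      have hvq1 := one_le_padicValRat_two_sub hq0 hvq (a := 1) (by decide) hq1
      have hv₃ : (m : ℤ) + 1 ≤ padicValRat 2 (x - (e₃ : ℚ)) := by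
        rw [hfac, padicValRat.mul hc0' hq1, hvc']; omega
      obtain ⟨sn, hsn⟩ : ∃ sn : ℕ, padicValRat 2 (x - (e₃ : ℚ)) = m + sn := by
        obtain ⟨sn, hsn⟩ := Int.eq_ofNat_of_zero_le (show 0 ≤ padicValRat 2 (x - (e₃ : ℚ)) - m by omega)
        exact ⟨sn, by omega⟩
      have hs24 : sn = 2 ∨ 4 ≤ sn := by
        rw [hzero, hsn, heq] at hsum; obtain ⟨j, hj⟩ := hsum; omega
      have hs1 : 1 ≤ sn := by omega
      have he : (2 : ZMod (2 ^ 3)) ^ sn = 4 ∨ (2 : ZMod (2 ^ 3)) ^ sn = 0 := by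
        rcases hs24 with rfl | h4
        · exact Or.inl rfl
        · exact Or.inr (two_pow_eq_zero_of_le (by omega))
      have hz₂ : x - (e₂ : ℚ) = ((e₃ : ℚ) - e₂) + (x - e₃) := by ring
      have hz₁ : x - (e₁ : ℚ) = ((e₃ : ℚ) - e₁) + (x - e₃) := by ring
      have hres₂ : res8 (x - (e₂ : ℚ)) = u8 + 2 ^ sn * res8 (x - (e₃ : ℚ)) := by
        rw [← hrc']; conv_lhs => rw [hz₂]
        exact res8_add_of_eq hc0' hs1 (by rw [hvc', hsn])
      have hres₁ : res8 (x - (e₁ : ℚ)) = b := by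
        rw [hz₁, res8_add_of_eq hb0 (k := m + sn) (by omega) (by rw [hvb, hsn]; push_cast; ring), hrb,
          two_pow_eq_zero_of_le (by omega), zero_mul, add_zero]
      have hp₂ : parityBit 2 (x - (e₂ : ℚ)) = (m : ZMod 2) :=
        parityBit_two_eq_natCast (by rw [← ht, heq]; simp)
      rw [hres₁, hres₂] at hprod
      rw [show (parityBit 2 (x - (e₁ : ℚ)), chi4 (x - (e₁ : ℚ)), chi8 (x - (e₁ : ℚ)), parityBit 2 (x - (e₂ : ℚ)),
          chi4 (x - (e₂ : ℚ)), chi8 (x - (e₂ : ℚ))) =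
          twoBits 0 b m (u8 + 2 ^ sn * res8 (x - (e₃ : ℚ))) by
        simp only [twoBits, chi4, chi8, hres₁, hres₂, hp₁, hp₂, Nat.cast_zero]]
      exact w00_of_C3 hab he hrr₃ hprod
    · -- (C2) `t > m`, `t - m` even
      have hv₃ : padicValRat 2 (x - (e₃ : ℚ)) = m := by
        rw [hy₃', (padicValRat_add_eq_left hc0 (Or.inr (by rw [hvc, ← ht]; exact hgt))).2, hvc]
      obtain ⟨sn, hsn⟩ : ∃ sn : ℕ, tn = m + sn := ⟨tn - m, by omega⟩
      rw [hzero, hv₃, htn, hsn] at hsum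
      obtain ⟨j, hj⟩ := hsum
      have hs24 : sn = 2 ∨ 4 ≤ sn := by omega
      have hs1 : 1 ≤ sn := by omega
      have he : (2 : ZMod (2 ^ 3)) ^ sn = 4 ∨ (2 : ZMod (2 ^ 3)) ^ sn = 0 := by
        rcases hs24 with rfl | h4
        · exact Or.inl rfl
        · exact Or.inr (two_pow_eq_zero_of_le (by omega))
      have hres₁ : res8 (x - (e₁ : ℚ)) = a := by
        rw [hx₁, res8_add_of_eq ha0 (k := tn) htn1 (by rw [hva, ← ht, htn]; ring), hra,
          two_pow_eq_zero_of_le (by omega), zero_mul, add_zero]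
      have hres₃ : res8 (x - (e₃ : ℚ)) = -u8 + 2 ^ sn * res8 (x - (e₂ : ℚ)) := by
        rw [← hrc]; conv_lhs => rw [hy₃']
        exact res8_add_of_eq hc0 hs1 (by rw [hvc, ← ht, htn, hsn]; push_cast; ring)
      have hp₂ : parityBit 2 (x - (e₂ : ℚ)) = (m : ZMod 2) :=
        parityBit_two_eq_natCast (by rw [← ht, htn, hsn]; exact ⟨j - m, by push_cast; omega⟩)
      rw [hres₁, hres₃] at hprod
      rw [show (parityBit 2 (x - (e₁ : ℚ)), chi4 (x - (e₁ : ℚ)), chi8 (x - (e₁ : ℚ)), parityBit 2 (x - (e₂ : ℚ)),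
          chi4 (x - (e₂ : ℚ)), chi8 (x - (e₂ : ℚ))) = twoBits 0 a m (res8 (x - (e₂ : ℚ))) by
        simp only [twoBits, chi4, chi8, hres₁, hp₁, hp₂, Nat.cast_zero]]
      exact w00_of_C2 he hrr₂ hprod
  · -- (B) `v > 0`, even: the other two factors are units
    obtain ⟨k, hk⟩ := Int.eq_ofNat_of_zero_le (show 0 ≤ v by omega)
    have hk24 : k = 2 ∨ 4 ≤ k := by obtain ⟨j, hj⟩ := hev; omega
    have hk1 : 1 ≤ k := by omega
    have he : (2 : ZMod (2 ^ 3)) ^ k = 4 ∨ (2 : ZMod (2 ^ 3)) ^ k = 0 := by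
      rcases hk24 with rfl | h4
      · exact Or.inl rfl
      · exact Or.inr (two_pow_eq_zero_of_le (by omega))
    have hv₂ : t = 0 := by
      rw [ht, hx₂', (padicValRat_add_eq_left ha0' (Or.inr (by rw [hva', ← hv]; exact hpos))).2, hva']
    have hres₂ : res8 (x - (e₂ : ℚ)) = -a + 2 ^ k * res8 (x - (e₁ : ℚ)) := by
      rw [← hra'']; conv_lhs => rw [hx₂']
      exact res8_add_of_eq ha0' hk1 (by rw [hva', ← hv, hk]; ring)
    have hres₃ : res8 (x - (e₃ : ℚ)) = -b + 2 ^ k * res8 (x - (e₁ : ℚ)) := by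
      rw [← hrb'']; conv_lhs => rw [hx₃']
      exact res8_add_of_eq hb0' hk1 (by rw [hvb', ← hv, hk]; ring)
    have hp₁ : parityBit 2 (x - (e₁ : ℚ)) = 0 := parityBit_eq_zero_iff.mpr hev
    have hp₂ : parityBit 2 (x - (e₂ : ℚ)) = 0 := parityBit_eq_zero_iff.mpr (by rw [← ht, hv₂]; exact ⟨0, rfl⟩)
    rw [hres₂, hres₃] at hprod
    rw [show (parityBit 2 (x - (e₁ : ℚ)), chi4 (x - (e₁ : ℚ)), chi8 (x - (e₁ : ℚ)), parityBit 2 (x - (e₂ : ℚ)),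
        chi4 (x - (e₂ : ℚ)), chi8 (x - (e₂ : ℚ))) =
        twoBits 0 (res8 (x - (e₁ : ℚ))) 0 (-a + 2 ^ k * res8 (x - (e₁ : ℚ))) by
      simp only [twoBits, chi4, chi8, hres₂, hp₁, hp₂, Nat.cast_zero]]
    exact w00_of_B hab he hrr₁ hprod

end Summit.BirchSwinnertonDyer.BirchSwinnertonDyer.Rank2Observatory
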